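import Mathlib
import Summits.AtomisticToContinuum.FouriersLaw.Theorems.EmbeddedDrudeMourreMourreDissolutionSlabRegionT1
import HarnessLib

/-!
# Slab non-concentration, region T₂ — helper file for `stub_slabNonconcentration` (stub NC)
of line `swap-odd-threshold-rigidity` (crux `EmbeddedDrudeMourre.MourreDissolution`, item
stmt-AtomisticToContinuum-12594; helper file, `--supports`)

Region T₂ of the exchange slab `{|sin((k₃−k₁)/2)| < η}` (`k₂` within `ρ₁` of `±κ*`, `k₃` at distance
`≥ ρ₂`): the `k₁`-fibre map `k₁ ↦ Ω(k₁,k₂,k₃)` has derivative `v(k₁) − v(k₁+k₂−k₃)` of modulus `≥ γ` (the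
velocity gap at the extremum, `velShape_gap_max/min`) on each of the three intervals `|k₃ − k₁ − 2πn| ≤ πη`;
the weighted fibre integral is `≤ 3·Cw η²·2r/γ` and the region bound `≤ (2π)²·3·Cw η²·2r/γ`.
No cited facts.
-/

noncomputable section

namespace Summit.AtomisticToContinuum.FouriersLaw.Theorems.MourreDissolution

open Real Set MeasureTheory Filter Topology
open scoped ENNReal
open Literature.MathematicalPhysics.KineticTheory.PhononBoltzmann

/-! ### Region T₂: the `k₁`-fibres when `k₂` is near `±κ*` and `k₃` is far -/

/-- **T₂ fibre bound.** If `|k₂ − ctr| ≤ ρ₁`, `|k₃ − ctr| ≥ ρ₂` (`k₃` in the cell) and the velocity gap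
at `ctr ∈ {κ*, −κ*}` holds with `(d₁, d₂, γ)`, `ρ₁ + πη ≤ d₁`, `d₂ + πη ≤ ρ₂`, `πη ≤ 1`, then the weighted
sublevel integral of the `k₁`-fibre over the slab part of the cell is `≤ 3·Cw η²·2r/γ`. [folklore] -/
theorem slabRegion_T2_fibre {ω₂ : ℝ} (hω : 0 < ω₂) {ρ₁ ρ₂ d₁ d₂ γ η Cw : ℝ} (hγ : 0 < γ) (hη : 0 < η)
    (hη1 : π * η ≤ 1) (hd₁ : ρ₁ + π * η ≤ d₁) (hd₂ : d₂ + π * η ≤ ρ₂) (hCw : 0 ≤ Cw) {ctr : ℝ}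
    (hgap : (∀ u t : ℝ, |u - ctr| ≤ d₁ → t ∈ Icc (-π - 1) (π + 1) → d₂ ≤ |t - ctr| →
        groupVelocity ω₂ t + γ ≤ groupVelocity ω₂ u) ∨
      (∀ u t : ℝ, |u - ctr| ≤ d₁ → t ∈ Icc (-π - 1) (π + 1) → d₂ ≤ |t - ctr| →
        groupVelocity ω₂ u + γ ≤ groupVelocity ω₂ t))
    {k₂ k₃ : ℝ} (hk₂ : |k₂ - ctr| ≤ ρ₁) (hk₃ : k₃ ∈ Ioc (-π) π) (hk₃far : ρ₂ ≤ |k₃ - ctr|)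
    {w : ℝ → ℝ≥0∞} (hw : ∀ k₁, |Real.sin ((k₃ - k₁) / 2)| < η → w k₁ ≤ ENNReal.ofReal (Cw * η ^ 2))
    {r : ℝ} (hr : 0 ≤ r) (E : ℝ) :
    ∫⁻ k₁ in Ioc (-π) π, {k₁ | |Real.sin ((k₃ - k₁) / 2)| < η}.indicator
        (fun k₁ => (Ioo (E - r) (E + r)).indicator 1 (resonanceFn ω₂ k₁ k₂ k₃) * w k₁) k₁ ≤
      ENNReal.ofReal (3 * (Cw * η ^ 2 * (2 * r / γ))) := by
  set v := groupVelocity ω₂ with hv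
  set g : ℝ → ℝ := fun k₁ => resonanceFn ω₂ k₁ k₂ k₃ with hg
  set G : ℝ → ℝ≥0∞ := fun k₁ => (Ioo (E - r) (E + r)).indicator 1 (g k₁) * ENNReal.ofReal (Cw * η ^ 2)
    with hG
  set L : ℤ → Set ℝ := fun n => Icc (k₃ - n * (2 * π) - π * η) (k₃ - n * (2 * π) + π * η) with hL
  -- expansion of the fibre map on each `L n`
  have hexp : ∀ n : ℤ, ∀ s ∈ L n, ∀ t ∈ L n, γ * |t - s| ≤ |g t - g s| := by
    intro n
    have hder : ∀ k₁ ∈ L n, HasDerivAt g (v k₁ - v (k₁ + k₂ - k₃)) k₁ := fun k₁ _ =>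
      slabFibre_hasDerivAt_k1 hω k₁ k₂ k₃
    -- rewrite the two velocities through `u = k₁ − k₃ + 2πn`
    have hred : ∀ k₁ ∈ L n, v k₁ = v (k₃ + (k₁ - k₃ + n * (2 * π))) ∧
        v (k₁ + k₂ - k₃) = v (k₂ + (k₁ - k₃ + n * (2 * π))) ∧ |k₁ - k₃ + n * (2 * π)| ≤ π * η := by
      intro k₁ hk₁
      refine ⟨?_, ?_, abs_le.2 ⟨by linarith [hk₁.1], by linarith [hk₁.2]⟩⟩
      · rw [show k₃ + (k₁ - k₃ + n * (2 * π)) = k₁ + n * (2 * π) by ring]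
        exact ((groupVelocity_periodic ω₂).int_mul n k₁).symm
      · rw [show k₂ + (k₁ - k₃ + n * (2 * π)) = k₁ + k₂ - k₃ + n * (2 * π) by ring]
        exact ((groupVelocity_periodic ω₂).int_mul n _).symm
    rcases hgap with hmax | hmin
    · refine slabFibre_expand_of_deriv_le (convex_Icc _ _) hder (fun k₁ hk₁ => ?_)
      obtain ⟨h1, h2, hu⟩ := hred k₁ hk₁
      have := hmax (k₂ + (k₁ - k₃ + n * (2 * π))) (k₃ + (k₁ - k₃ + n * (2 * π)))
        (by rw [show k₂ + (k₁ - k₃ + n * (2 * π)) - ctr = (k₂ - ctr) + (k₁ - k₃ + n * (2 * π)) by ring]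
            exact (abs_add_le _ _).trans (by linarith))
        ⟨by linarith [hk₃.1, (abs_le.1 hu).1], by linarith [hk₃.2, (abs_le.1 hu).2]⟩
        (by
          have : |k₃ - ctr| ≤ |k₃ + (k₁ - k₃ + ↑n * (2 * π)) - ctr| + |k₁ - k₃ + ↑n * (2 * π)| := by
            rw [show k₃ - ctr = (k₃ + (k₁ - k₃ + n * (2 * π)) - ctr) - (k₁ - k₃ + n * (2 * π)) by ring]
            exact abs_sub _ _
          linarith)
      rw [h1, h2]; linarith
    · refine slabFibre_expand_of_deriv_ge (convex_Icc _ _) hder (fun k₁ hk₁ => ?_)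
      obtain ⟨h1, h2, hu⟩ := hred k₁ hk₁
      have := hmin (k₂ + (k₁ - k₃ + n * (2 * π))) (k₃ + (k₁ - k₃ + n * (2 * π)))
        (by rw [show k₂ + (k₁ - k₃ + n * (2 * π)) - ctr = (k₂ - ctr) + (k₁ - k₃ + n * (2 * π)) by ring]
            exact (abs_add_le _ _).trans (by linarith))
        ⟨by linarith [hk₃.1, (abs_le.1 hu).1], by linarith [hk₃.2, (abs_le.1 hu).2]⟩
        (by
          have : |k₃ - ctr| ≤ |k₃ + (k₁ - k₃ + ↑n * (2 * π)) - ctr| + |k₁ - k₃ + ↑n * (2 * π)| := by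
            rw [show k₃ - ctr = (k₃ + (k₁ - k₃ + n * (2 * π)) - ctr) - (k₁ - k₃ + n * (2 * π)) by ring]
            exact abs_sub _ _
          linarith)
      rw [h1, h2]; linarith
  -- each piece
  have hpiece : ∀ n : ℤ, ∫⁻ k₁ in L n, G k₁ ≤ ENNReal.ofReal (Cw * η ^ 2 * (2 * r / γ)) := by
    intro n
    have h := slabFibre_weighted_le (g := g) measurableSet_Icc hγ (hexp n)
      (w := fun _ => ENNReal.ofReal (Cw * η ^ 2)) (B := ENNReal.ofReal (Cw * η ^ 2)) (fun _ _ => le_rfl) E r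
    rw [← ENNReal.ofReal_mul (by positivity)] at h
    exact h
  -- pointwise domination of the integrand by the three pieces
  have hpt : ∀ k₁, (Ioc (-π) π).indicator ({k₁ | |Real.sin ((k₃ - k₁) / 2)| < η}.indicator
      (fun k₁ => (Ioo (E - r) (E + r)).indicator 1 (resonanceFn ω₂ k₁ k₂ k₃) * w k₁)) k₁ ≤
      (L (-1)).indicator G k₁ + (L 0).indicator G k₁ + (L 1).indicator G k₁ := by
    intro k₁
    by_cases hk₁ : k₁ ∈ Ioc (-π) π
    · rw [indicator_of_mem hk₁]
      by_cases hsl : |Real.sin ((k₃ - k₁) / 2)| < η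
      · rw [indicator_of_mem (show k₁ ∈ {k₁ | |Real.sin ((k₃ - k₁) / 2)| < η} from hsl)]
        have hle : (Ioo (E - r) (E + r)).indicator 1 (resonanceFn ω₂ k₁ k₂ k₃) * w k₁ ≤ G k₁ := by
          simp only [hG, hg]; gcongr; exact hw k₁ hsl
        obtain ⟨m, x, hx, hxπ, hxS, -⟩ := slabFibre_reduce (k₃ - k₁)
        have hu : |k₃ - k₁| < 2 * π := by
          rw [abs_lt]; constructor <;> linarith [hk₁.1, hk₁.2, hk₃.1, hk₃.2]
        have hxη : |x| ≤ π * η := hxS.trans (by nlinarith [pi_pos, hsl.le])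
        have hmem : k₁ ∈ L m := by
          simp only [hL, mem_Icc]
          constructor <;> [linarith [(abs_le.1 hxη).2]; linarith [(abs_le.1 hxη).1]]
        rcases slabFibre_reduce_int_le hu hxπ hx with h | h | h <;> rw [h] at hmem
        · calc _ ≤ G k₁ := hle
            _ = (L (-1)).indicator G k₁ := (indicator_of_mem hmem G).symm
            _ ≤ _ := le_self_add.trans le_self_add
        · calc _ ≤ G k₁ := hle
            _ = (L 0).indicator G k₁ := (indicator_of_mem hmem G).symm
            _ ≤ _ := le_add_self.trans le_self_add
        · calc _ ≤ G k₁ := hle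
            _ = (L 1).indicator G k₁ := (indicator_of_mem hmem G).symm
            _ ≤ _ := le_add_self
      · rw [indicator_of_notMem (show k₁ ∉ {k₁ | |Real.sin ((k₃ - k₁) / 2)| < η} from hsl)]
        exact bot_le
    · rw [indicator_of_notMem hk₁]; exact bot_le
  -- measurability of the pieces
  have hgc : Continuous g := by
    simp only [hg]; unfold resonanceFn dispersion; fun_prop
  have hGm : Measurable G :=
    ((measurable_one.indicator measurableSet_Ioo).comp hgc.measurable).mul_const _
  have hLm : ∀ n, Measurable ((L n).indicator G) := fun n => hGm.indicator measurableSet_Icc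
  calc _ = ∫⁻ k₁, (Ioc (-π) π).indicator ({k₁ | |Real.sin ((k₃ - k₁) / 2)| < η}.indicator
          (fun k₁ => (Ioo (E - r) (E + r)).indicator 1 (resonanceFn ω₂ k₁ k₂ k₃) * w k₁)) k₁ :=
        (lintegral_indicator measurableSet_Ioc _).symm
    _ ≤ ∫⁻ k₁, ((L (-1)).indicator G k₁ + (L 0).indicator G k₁ + (L 1).indicator G k₁) := lintegral_mono hpt
    _ = (∫⁻ k₁ in L (-1), G k₁) + (∫⁻ k₁ in L 0, G k₁) + ∫⁻ k₁ in L 1, G k₁ := by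
        rw [lintegral_add_right _ (hLm 1), lintegral_add_right _ (hLm 0), lintegral_indicator measurableSet_Icc,
          lintegral_indicator measurableSet_Icc, lintegral_indicator measurableSet_Icc]
    _ ≤ ENNReal.ofReal (Cw * η ^ 2 * (2 * r / γ)) + ENNReal.ofReal (Cw * η ^ 2 * (2 * r / γ)) +
          ENNReal.ofReal (Cw * η ^ 2 * (2 * r / γ)) := by
        gcongr <;> exact hpiece _
    _ = ENNReal.ofReal (3 * (Cw * η ^ 2 * (2 * r / γ))) := by
        rw [← ENNReal.ofReal_add (by positivity) (by positivity),
          ← ENNReal.ofReal_add (by positivity) (by positivity)]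
        congr 1; ring


/-- **Region T₂.** The weighted sublevel mass of the part of the slab where `k₂` is within `ρ₁` of
`ctr ∈ {κ*, −κ*}` and `k₃` is `ρ₂`-far from `ctr` is `≤ (2π)²·3·Cw η²·2r/γ`. [folklore] -/
theorem slabRegion_T2 {ω₂ : ℝ} (hω : 0 < ω₂) {ρ₁ ρ₂ d₁ d₂ γ η Cw : ℝ} (hγ : 0 < γ) (hη : 0 < η)
    (hη1 : π * η ≤ 1) (hd₁ : ρ₁ + π * η ≤ d₁) (hd₂ : d₂ + π * η ≤ ρ₂) (hCw : 0 ≤ Cw) {ctr : ℝ}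
    (hgap : (∀ u t : ℝ, |u - ctr| ≤ d₁ → t ∈ Icc (-π - 1) (π + 1) → d₂ ≤ |t - ctr| →
        groupVelocity ω₂ t + γ ≤ groupVelocity ω₂ u) ∨
      (∀ u t : ℝ, |u - ctr| ≤ d₁ → t ∈ Icc (-π - 1) (π + 1) → d₂ ≤ |t - ctr| →
        groupVelocity ω₂ u + γ ≤ groupVelocity ω₂ t))
    {w : ℝ × ℝ × ℝ → ℝ≥0∞} (hwm : Measurable w)
    (hw : ∀ p, w p ≤ ENNReal.ofReal (Cw * Real.sin ((p.2.1 - p.1) / 2) ^ 2)) {r : ℝ} (hr : 0 ≤ r) (E : ℝ) :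
    ∫⁻ p in (Ioc (-π) π ×ˢ (Ioc (-π) π ×ˢ Ioc (-π) π)) ∩ {p | |Real.sin ((p.2.1 - p.1) / 2)| < η} ∩
        {p | |p.2.2 - ctr| ≤ ρ₁ ∧ ρ₂ ≤ |p.2.1 - ctr|},
      (Ioo (E - r) (E + r)).indicator 1 (resonanceFn ω₂ p.1 p.2.2 p.2.1) * w p ≤
      ENNReal.ofReal ((2 * π) ^ 2 * (3 * (Cw * η ^ 2 * (2 * r / γ)))) := by
  set I : Set ℝ := Ioc (-π) π with hI
  set F : ℝ × ℝ × ℝ → ℝ≥0∞ := fun p =>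
    (Ioo (E - r) (E + r)).indicator 1 (resonanceFn ω₂ p.1 p.2.2 p.2.1) * w p with hF
  set S : Set (ℝ × ℝ × ℝ) := (I ×ˢ (I ×ˢ I)) ∩ {p | |Real.sin ((p.2.1 - p.1) / 2)| < η} ∩
    {p | |p.2.2 - ctr| ≤ ρ₁ ∧ ρ₂ ≤ |p.2.1 - ctr|} with hS
  have hNm : MeasurableSet {p : ℝ × ℝ × ℝ | |p.2.2 - ctr| ≤ ρ₁ ∧ ρ₂ ≤ |p.2.1 - ctr|} := by
    have h1 : MeasurableSet {p : ℝ × ℝ × ℝ | |p.2.2 - ctr| ≤ ρ₁} :=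
      (isClosed_le (by fun_prop : Continuous fun p : ℝ × ℝ × ℝ => |p.2.2 - ctr|) continuous_const).measurableSet
    have h2 : MeasurableSet {p : ℝ × ℝ × ℝ | ρ₂ ≤ |p.2.1 - ctr|} :=
      (isClosed_le continuous_const (by fun_prop : Continuous fun p : ℝ × ℝ × ℝ => |p.2.1 - ctr|)).measurableSet
    exact h1.inter h2
  have hSm : MeasurableSet S :=
    ((measurableSet_Ioc.prod (measurableSet_Ioc.prod measurableSet_Ioc)).inter
      (slabRegion_measurableSet_slab η)).inter hNm
  have hFm : Measurable F := slabRegion_measurable_F hwm E r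
  set B : ℝ≥0∞ := ENNReal.ofReal (3 * (Cw * η ^ 2 * (2 * r / γ))) with hB
  -- the fibre bound, pointwise in `(k₃, k₂)`
  have hfib : ∀ k₃ k₂, ∫⁻ k₁, S.indicator F (k₁, (k₃, k₂)) ≤ I.indicator 1 k₃ * (I.indicator 1 k₂ * B) := by
    intro k₃ k₂
    by_cases hk₃ : k₃ ∈ I
    · by_cases hk₂ : k₂ ∈ I
      · simp only [indicator_of_mem hk₃, indicator_of_mem hk₂, Pi.one_apply, one_mul]
        by_cases hN : |k₂ - ctr| ≤ ρ₁ ∧ ρ₂ ≤ |k₃ - ctr|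
        · have hpt : ∀ k₁, S.indicator F (k₁, (k₃, k₂)) ≤
              I.indicator ({k₁ | |Real.sin ((k₃ - k₁) / 2)| < η}.indicator
                (fun k₁ => (Ioo (E - r) (E + r)).indicator 1 (resonanceFn ω₂ k₁ k₂ k₃) *
                  w (k₁, (k₃, k₂)))) k₁ := by
            intro k₁
            by_cases hp : (k₁, (k₃, k₂)) ∈ S
            · rw [indicator_of_mem hp, indicator_of_mem (show k₁ ∈ I from hp.1.1.1),
                indicator_of_mem (show k₁ ∈ {k₁ | |Real.sin ((k₃ - k₁) / 2)| < η} from hp.1.2)]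
            · rw [indicator_of_notMem hp]; exact bot_le
          have hw' : ∀ k₁, |Real.sin ((k₃ - k₁) / 2)| < η →
              w (k₁, (k₃, k₂)) ≤ ENNReal.ofReal (Cw * η ^ 2) := fun k₁ hk₁ => by
            refine (hw (k₁, (k₃, k₂))).trans (ENNReal.ofReal_le_ofReal ?_)
            apply mul_le_mul_of_nonneg_left _ hCw
            have := abs_nonneg (Real.sin ((k₃ - k₁) / 2))
            rw [← sq_abs]; nlinarith
          calc ∫⁻ k₁, S.indicator F (k₁, (k₃, k₂)) ≤ _ := lintegral_mono hpt
            _ = ∫⁻ k₁ in I, {k₁ | |Real.sin ((k₃ - k₁) / 2)| < η}.indicator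
                  (fun k₁ => (Ioo (E - r) (E + r)).indicator 1 (resonanceFn ω₂ k₁ k₂ k₃) *
                    w (k₁, (k₃, k₂))) k₁ := lintegral_indicator measurableSet_Ioc _
            _ ≤ B := slabRegion_T2_fibre hω hγ hη hη1 hd₁ hd₂ hCw hgap hN.1 hk₃ hN.2 hw' hr E
        · have h0 : ∀ k₁, S.indicator F (k₁, (k₃, k₂)) = 0 := fun k₁ =>
            indicator_of_notMem (fun hp => hN hp.2) _
          simp only [h0, lintegral_zero]; exact bot_le
      · have h0 : ∀ k₁, S.indicator F (k₁, (k₃, k₂)) = 0 := fun k₁ =>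
          indicator_of_notMem (fun hp => hk₂ hp.1.1.2.2) _
        simp only [h0, lintegral_zero]; exact bot_le
    · have h0 : ∀ k₁, S.indicator F (k₁, (k₃, k₂)) = 0 := fun k₁ =>
        indicator_of_notMem (fun hp => hk₃ hp.1.1.2.1) _
      simp only [h0, lintegral_zero]; exact bot_le
  have hIvol : volume I = ENNReal.ofReal (2 * π) := by
    rw [hI, Real.volume_Ioc]; congr 1; ring
  have hmI : Measurable (I.indicator (1 : ℝ → ℝ≥0∞)) := measurable_one.indicator measurableSet_Ioc
  calc ∫⁻ p in S, F p = ∫⁻ p, S.indicator F p := (lintegral_indicator hSm F).symm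
    _ = ∫⁻ q, ∫⁻ k₁, S.indicator F (k₁, q) := by
        rw [Measure.volume_eq_prod]
        exact lintegral_prod_symm _ (hFm.indicator hSm).aemeasurable
    _ ≤ ∫⁻ k₃, ∫⁻ k₂, ∫⁻ k₁, S.indicator F (k₁, (k₃, k₂)) := by
        rw [Measure.volume_eq_prod]; exact lintegral_prod_le _
    _ ≤ ∫⁻ k₃, ∫⁻ k₂, I.indicator 1 k₃ * (I.indicator 1 k₂ * B) :=
        lintegral_mono fun k₃ => lintegral_mono fun k₂ => hfib k₃ k₂
    _ = ENNReal.ofReal (2 * π) * (ENNReal.ofReal (2 * π) * B) := by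
        have hinner : ∀ k₃, ∫⁻ k₂, I.indicator 1 k₃ * (I.indicator 1 k₂ * B) =
            I.indicator 1 k₃ * (ENNReal.ofReal (2 * π) * B) := fun k₃ => by
          rw [lintegral_const_mul _ (hmI.mul_const B), lintegral_mul_const B hmI,
            lintegral_indicator_one measurableSet_Ioc, hIvol]
        rw [lintegral_congr hinner, lintegral_mul_const _ hmI, lintegral_indicator_one measurableSet_Ioc,
          hIvol]
    _ = ENNReal.ofReal ((2 * π) ^ 2 * (3 * (Cw * η ^ 2 * (2 * r / γ)))) := by
        rw [hB, ← ENNReal.ofReal_mul (by positivity), ← ENNReal.ofReal_mul (by positivity)]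
        congr 1; ring

end Summit.AtomisticToContinuum.FouriersLaw.Theorems.MourreDissolution
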